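import Summits.Ventures.PercRepro.C041TriDomTwoCutCount

/-!
# ROW C-041 — THE FAR SIDE OF A 2-CUT, IV: THE 2-CUT COUNT, THE `R`/`B`-FIBRES
(p6, gen 46; P6-TWOEXIT-LEAN.md §53 ADDENDUM 18)

**THE 2-CUT COUNT** (`dom_of_twoCut_count`): for two cut-related predicates `P, Q` (`CutRel`, part III) whose three
reductions satisfy the domination statements on every up-set, and a red-ward injection `ψ` of the `B`-type inside
parts into the `R`-type ones (THE TRANSPORT), `#{V ∧ P} ≤ #{V ∧ Q}` on every up-set.  The `R`/`B`-fibres: pair each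
`B`-type inside part `i` with `ψ i`; for each colour `b` of the chord coordinate (dead in `P`, alive in `PC`) the
statement on `PC` at the up-set `pairU` — «chord red: `V` read at the fibre `ψ i`; chord blue: at the fibre `i`»,
the chord coordinate of the outside part normalised to `b` — bounds the `b`-halves of the two fibres together
(`pair_le`, by `card_pairU`); an `R`-type part not hit by `ψ` is bounded alone (`unmatched_le`, by `singleU`).
The four types partition the inside parts (`hsplit`), the image of `ψ` sits inside the `R`-type parts, and the sums
add up.
-/

namespace PercRepro

namespace ZoneZ

namespace MultiExit

open ZoneData Finset

section Count

variable {E₁ : Type} [Fintype E₁] [DecidableEq E₁] {In : E₁ → Prop} [DecidablePred In] {c₀ : E₁}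
variable {r bl : (E₁ → Bool) → Prop}

/-! ## The `R`/`B`-fibres: pairs and the unmatched -/

variable (In c₀) in
open Classical in
/-- The up-set of a pair `(i, j)` of inside parts at the chord colour `b`: read `V` at the fibre `j` when the chord
is red, at the fibre `i` when it is blue, with the chord coordinate of the outside part normalised to `b`. -/
def pairU (V : (E₁ → Bool) → Prop) (i j : E₁ → Bool) (b : Bool) : (E₁ → Bool) → Prop :=
  fun ω => if (outN In ω) c₀ = true then V (merge In (Function.update (outN In ω) c₀ b) j)
    else V (merge In (Function.update (outN In ω) c₀ b) i)

variable (In c₀) in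
open Classical in
/-- The up-set of an unmatched `R`-type inside part `j` at the chord colour `b`: the chord red and `V` at `j`. -/
def singleU (V : (E₁ → Bool) → Prop) (j : E₁ → Bool) (b : Bool) : (E₁ → Bool) → Prop :=
  fun ω => (outN In ω) c₀ = true ∧ V (merge In (Function.update (outN In ω) c₀ b) j)

omit [Fintype E₁] in
variable (In c₀) in
open Classical in
/-- `pairU` is an up-set when `i ≤ j`. -/
theorem upSet_pairU {V : (E₁ → Bool) → Prop} (hV : UpSet V) {i j : E₁ → Bool} (hij : LeCol i j) (b : Bool) :
    UpSet (pairU In c₀ V i j b) := by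
  intro ω ω' hω hle
  unfold pairU at hω ⊢
  have hle' := leCol_outN In hle
  by_cases h1 : (outN In ω) c₀ = true
  · have h2 : (outN In ω') c₀ = true := hle' c₀ h1
    rw [if_pos h1] at hω
    rw [if_pos h2]
    exact hV _ _ hω (leCol_merge_left In (leCol_update c₀ hle' b) j)
  · rw [if_neg h1] at hω
    by_cases h2 : (outN In ω') c₀ = true
    · rw [if_pos h2]
      exact hV _ _ hω fun e he =>
        leCol_merge_right In _ hij e (leCol_merge_left In (leCol_update c₀ hle' b) i e he)
    · rw [if_neg h2]
      exact hV _ _ hω (leCol_merge_left In (leCol_update c₀ hle' b) i)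

omit [Fintype E₁] in
variable (In c₀) in
open Classical in
/-- `singleU` is an up-set. -/
theorem upSet_singleU {V : (E₁ → Bool) → Prop} (hV : UpSet V) (j : E₁ → Bool) (b : Bool) :
    UpSet (singleU In c₀ V j b) := by
  intro ω ω' hω hle
  unfold singleU at hω ⊢
  have hle' := leCol_outN In hle
  exact ⟨hle' c₀ hω.1, hV _ _ hω.2 (leCol_merge_left In (leCol_update c₀ hle' b) j)⟩

omit [Fintype E₁] in
/-- An outside part read after a recolouring of its chord to its own colour is itself. -/
theorem update_chord_self {o : E₁ → Bool} {b : Bool} (h : o c₀ = b) : Function.update o c₀ b = o := by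
  rw [← h, Function.update_eq_self]

open Classical in
/-- The count of `pairU` against a cut-related predicate: the `b`-halves of the two fibres, each `#InSupp` times. -/
theorem card_pairU (hc : ¬ In c₀) {P PN PD PC : (E₁ → Bool) → Prop} (hP : CutRel In c₀ r bl P PN PD PC)
    (V : (E₁ → Bool) → Prop) {i j : E₁ → Bool} (hi : i ∈ InSupp In) (hBi : bl i ∧ ¬ r i) (hj : j ∈ InSupp In)
    (hRj : r j ∧ ¬ bl j) (b : Bool) :
    (univ.filter fun ω => pairU In c₀ V i j b ω ∧ PC ω).card =
      (InSupp In).card * (fibH In c₀ V P j b + fibH In c₀ V P i b) := by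
  have hPCj : ∀ o ∈ OutSupp In, PC (Function.update o c₀ true) ↔ P (merge In o j) := by
    intro o ho
    rw [hP.hC o j ho hj (iff_of_false hRj.2 (not_not.mpr hRj.1)), decide_eq_true hRj.1]
  have hPCi : ∀ o ∈ OutSupp In, PC (Function.update o c₀ false) ↔ P (merge In o i) := by
    intro o ho
    rw [hP.hC o i ho hi (iff_of_true hBi.1 hBi.2), decide_eq_false hBi.2]
  rw [card_filter_inst.trans (card_filter_outOnly In _ fun ω => ?_)]
  · congr 1
    rw [← Finset.card_filter_add_card_filter_not (fun o => o c₀ = true), Finset.filter_filter, Finset.filter_filter]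
    unfold fibH
    congr 1
    · refine (card_filter_congr' fun o ho => ?_).trans
        ((card_reindex_chord In c₀ hc (fun o => V (merge In o j) ∧ PC (Function.update o c₀ true)) true b).trans
          (card_filter_congr' fun o ho => and_congr_right fun _ => and_congr_right fun _ => hPCj o ho))
      unfold pairU
      rw [outN_eq_self In ho]
      constructor
      · rintro ⟨⟨h2, h3⟩, h1⟩
        rw [if_pos h1] at h2
        refine ⟨h1, h2, ?_⟩
        rw [Function.update_idem, update_chord_self h1]
        exact h3
      · rintro ⟨h1, h2, h3⟩
        rw [Function.update_idem, update_chord_self h1] at h3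
        rw [if_pos h1]
        exact ⟨⟨h2, h3⟩, h1⟩
    · refine (card_filter_congr' fun o ho => ?_).trans
        ((card_reindex_chord In c₀ hc (fun o => V (merge In o i) ∧ PC (Function.update o c₀ false)) false b).trans
          (card_filter_congr' fun o ho => and_congr_right fun _ => and_congr_right fun _ => hPCi o ho))
      unfold pairU
      rw [outN_eq_self In ho, Bool.not_eq_true]
      constructor
      · rintro ⟨⟨h2, h3⟩, h1⟩
        rw [if_neg (by rw [h1]; decide)] at h2
        refine ⟨h1, h2, ?_⟩
        rw [Function.update_idem, update_chord_self h1]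
        exact h3
      · rintro ⟨h1, h2, h3⟩
        rw [Function.update_idem, update_chord_self h1] at h3
        rw [if_neg (by rw [h1]; decide)]
        exact ⟨⟨h2, h3⟩, h1⟩
  · unfold pairU
    rw [outN_eq_self In (outN_mem_OutSupp In ω)]
    exact and_congr_right fun _ => (hP.hout ω).2.2

open Classical in
/-- The count of `singleU` against a cut-related predicate: the `b`-half of the fibre, `#InSupp` times. -/
theorem card_singleU (hc : ¬ In c₀) {P PN PD PC : (E₁ → Bool) → Prop} (hP : CutRel In c₀ r bl P PN PD PC)
    (V : (E₁ → Bool) → Prop) {j : E₁ → Bool} (hj : j ∈ InSupp In) (hRj : r j ∧ ¬ bl j) (b : Bool) :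
    (univ.filter fun ω => singleU In c₀ V j b ω ∧ PC ω).card = (InSupp In).card * fibH In c₀ V P j b := by
  have hPCj : ∀ o ∈ OutSupp In, PC (Function.update o c₀ true) ↔ P (merge In o j) := by
    intro o ho
    rw [hP.hC o j ho hj (iff_of_false hRj.2 (not_not.mpr hRj.1)), decide_eq_true hRj.1]
  rw [card_filter_inst.trans (card_filter_outOnly In _ fun ω => ?_)]
  · congr 1
    unfold fibH
    refine (card_filter_congr' fun o ho => ?_).trans
      ((card_reindex_chord In c₀ hc (fun o => V (merge In o j) ∧ PC (Function.update o c₀ true)) true b).trans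
        (card_filter_congr' fun o ho => and_congr_right fun _ => and_congr_right fun _ => hPCj o ho))
    unfold singleU
    rw [outN_eq_self In ho]
    constructor
    · rintro ⟨⟨h1, h2⟩, h3⟩
      refine ⟨h1, h2, ?_⟩
      rw [Function.update_idem, update_chord_self h1]
      exact h3
    · rintro ⟨h1, h2, h3⟩
      rw [Function.update_idem, update_chord_self h1] at h3
      exact ⟨⟨h1, h2⟩, h3⟩
  · unfold singleU
    rw [outN_eq_self In (outN_mem_OutSupp In ω)]
    exact and_congr_right fun _ => (hP.hout ω).2.2

open Classical in
/-- A PAIR: the `b`-halves of a `B`-fibre `i` and of an `R`-fibre `j ≥ i` together are bounded by the statement on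
the chord reductions. -/
theorem pair_le (hc : ¬ In c₀) {P PN PD PC Q QN QD QC : (E₁ → Bool) → Prop} (hP : CutRel In c₀ r bl P PN PD PC)
    (hQ : CutRel In c₀ r bl Q QN QD QC)
    (hCd : ∀ V : (E₁ → Bool) → Prop, UpSet V →
      (univ.filter fun ω => V ω ∧ PC ω).card ≤ (univ.filter fun ω => V ω ∧ QC ω).card)
    {V : (E₁ → Bool) → Prop} (hV : UpSet V) {i j : E₁ → Bool} (hi : i ∈ InSupp In) (hBi : bl i ∧ ¬ r i)
    (hj : j ∈ InSupp In) (hRj : r j ∧ ¬ bl j) (hij : LeCol i j) (b : Bool) :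
    fibH In c₀ V P j b + fibH In c₀ V P i b ≤ fibH In c₀ V Q j b + fibH In c₀ V Q i b := by
  have key := hCd (pairU In c₀ V i j b) (upSet_pairU In c₀ hV hij b)
  rw [card_pairU hc hP V hi hBi hj hRj b, card_pairU hc hQ V hi hBi hj hRj b] at key
  exact Nat.le_of_mul_le_mul_left key (card_InSupp_pos In)

open Classical in
/-- AN UNMATCHED `R`-FIBRE: its `b`-half is bounded by the statement on the chord reductions. -/
theorem unmatched_le (hc : ¬ In c₀) {P PN PD PC Q QN QD QC : (E₁ → Bool) → Prop}
    (hP : CutRel In c₀ r bl P PN PD PC) (hQ : CutRel In c₀ r bl Q QN QD QC)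
    (hCd : ∀ V : (E₁ → Bool) → Prop, UpSet V →
      (univ.filter fun ω => V ω ∧ PC ω).card ≤ (univ.filter fun ω => V ω ∧ QC ω).card)
    {V : (E₁ → Bool) → Prop} (hV : UpSet V) {j : E₁ → Bool} (hj : j ∈ InSupp In) (hRj : r j ∧ ¬ bl j) (b : Bool) :
    fibH In c₀ V P j b ≤ fibH In c₀ V Q j b := by
  have key := hCd (singleU In c₀ V j b) (upSet_singleU In c₀ hV j b)
  rw [card_singleU hc hP V hj hRj b, card_singleU hc hQ V hj hRj b] at key
  exact Nat.le_of_mul_le_mul_left key (card_InSupp_pos In)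

/-! ## The 2-cut count -/

open Classical in
/-- **THE 2-CUT COUNT**: a domination statement `#{V ∧ P} ≤ #{V ∧ Q}` on every up-set follows from the same
statements on the three reductions `(PN, QN)`, `(PD, QD)`, `(PC, QC)` of two cut-related predicates, given a red-ward
injection `ψ` of the `B`-type inside parts into the `R`-type ones. -/
theorem dom_of_twoCut_count (hc : ¬ In c₀) {P PN PD PC Q QN QD QC : (E₁ → Bool) → Prop}
    (hP : CutRel In c₀ r bl P PN PD PC) (hQ : CutRel In c₀ r bl Q QN QD QC)
    (hN : ∀ V : (E₁ → Bool) → Prop, UpSet V →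
      (univ.filter fun ω => V ω ∧ PN ω).card ≤ (univ.filter fun ω => V ω ∧ QN ω).card)
    (hD : ∀ V : (E₁ → Bool) → Prop, UpSet V →
      (univ.filter fun ω => V ω ∧ PD ω).card ≤ (univ.filter fun ω => V ω ∧ QD ω).card)
    (hCd : ∀ V : (E₁ → Bool) → Prop, UpSet V →
      (univ.filter fun ω => V ω ∧ PC ω).card ≤ (univ.filter fun ω => V ω ∧ QC ω).card)
    (ψ : (E₁ → Bool) → (E₁ → Bool))
    (hψ : ∀ i ∈ InSupp In, bl i → ¬ r i → ψ i ∈ InSupp In ∧ (r (ψ i) ∧ ¬ bl (ψ i)) ∧ LeCol i (ψ i))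
    (hinj : Set.InjOn ψ ↑((InSupp In).filter fun i => bl i ∧ ¬ r i))
    (V : (E₁ → Bool) → Prop) (hV : UpSet V) :
    (univ.filter fun ω => V ω ∧ P ω).card ≤ (univ.filter fun ω => V ω ∧ Q ω).card := by
  rw [card_eq_sum_fibC In V P, card_eq_sum_fibC In V Q]
  -- the four types
  have hsplit : ∀ X : (E₁ → Bool) → Prop, ∑ i ∈ InSupp In, fibC In V X i =
      (∑ i ∈ (InSupp In).filter fun i => ¬ r i ∧ ¬ bl i, fibC In V X i) +
        (∑ i ∈ (InSupp In).filter fun i => r i ∧ bl i, fibC In V X i) +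
        ((∑ i ∈ (InSupp In).filter fun i => bl i ∧ ¬ r i, fibC In V X i) +
          ∑ i ∈ (InSupp In).filter fun i => r i ∧ ¬ bl i, fibC In V X i) := by
    intro X
    rw [← Finset.sum_filter_add_sum_filter_not (InSupp In) (fun i => r i),
      ← Finset.sum_filter_add_sum_filter_not ((InSupp In).filter fun i => r i) (fun i => bl i),
      ← Finset.sum_filter_add_sum_filter_not ((InSupp In).filter fun i => ¬ r i) (fun i => bl i),
      Finset.filter_filter, Finset.filter_filter, Finset.filter_filter, Finset.filter_filter]
    have e1 : ((InSupp In).filter fun i => r i ∧ ¬ bl i) = (InSupp In).filter fun i => r i ∧ ¬ bl i := rfl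
    have e2 : ((InSupp In).filter fun i => ¬ r i ∧ bl i) = (InSupp In).filter fun i => bl i ∧ ¬ r i :=
      Finset.filter_congr fun i _ => and_comm
    rw [e2]
    ring
  rw [hsplit P, hsplit Q]
  -- the `N`- and `D`-fibres
  have hNs : (∑ i ∈ (InSupp In).filter fun i => ¬ r i ∧ ¬ bl i, fibC In V P i) ≤
      ∑ i ∈ (InSupp In).filter fun i => ¬ r i ∧ ¬ bl i, fibC In V Q i := by
    refine Finset.sum_le_sum fun i hi => ?_
    rw [Finset.mem_filter] at hi
    exact fib_N_le hP hQ hN hV hi.1 hi.2.1 hi.2.2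
  have hDs : (∑ i ∈ (InSupp In).filter fun i => r i ∧ bl i, fibC In V P i) ≤
      ∑ i ∈ (InSupp In).filter fun i => r i ∧ bl i, fibC In V Q i := by
    refine Finset.sum_le_sum fun i hi => ?_
    rw [Finset.mem_filter] at hi
    exact fib_D_le hP hQ hD hV hi.1 hi.2.1 hi.2.2
  -- the `R`/`B`-fibres: the image of the `B`-type parts inside the `R`-type parts
  set IB := (InSupp In).filter fun i => bl i ∧ ¬ r i with hIB
  set IR := (InSupp In).filter fun i => r i ∧ ¬ bl i with hIR
  have himg : IB.image ψ ⊆ IR := by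
    intro j hj
    rw [Finset.mem_image] at hj
    obtain ⟨i, hi, rfl⟩ := hj
    rw [hIB, Finset.mem_filter] at hi
    rw [hIR, Finset.mem_filter]
    exact ⟨(hψ i hi.1 hi.2.1 hi.2.2).1, (hψ i hi.1 hi.2.1 hi.2.2).2.1⟩
  have hRB : ∀ X : (E₁ → Bool) → Prop, (∑ i ∈ IB, fibC In V X i) + ∑ j ∈ IR, fibC In V X j =
      (∑ i ∈ IB, (fibC In V X i + fibC In V X (ψ i))) + ∑ j ∈ IR \ IB.image ψ, fibC In V X j := by
    intro X
    rw [← Finset.sum_sdiff himg, Finset.sum_image fun x hx y hy h => hinj (Finset.mem_coe.mpr hx) (Finset.mem_coe.mpr hy) h,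
      Finset.sum_add_distrib]
    ring
  rw [hRB P, hRB Q]
  have hpairs : (∑ i ∈ IB, (fibC In V P i + fibC In V P (ψ i))) ≤ ∑ i ∈ IB, (fibC In V Q i + fibC In V Q (ψ i)) := by
    refine Finset.sum_le_sum fun i hi => ?_
    rw [hIB, Finset.mem_filter] at hi
    obtain ⟨hψi, hRψ, hle⟩ := hψ i hi.1 hi.2.1 hi.2.2
    rw [fibC_eq_halves In c₀ V P i, fibC_eq_halves In c₀ V P (ψ i), fibC_eq_halves In c₀ V Q i,
      fibC_eq_halves In c₀ V Q (ψ i)]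
    have h1 := pair_le hc hP hQ hCd hV hi.1 hi.2 hψi hRψ hle true
    have h2 := pair_le hc hP hQ hCd hV hi.1 hi.2 hψi hRψ hle false
    omega
  have hunm : (∑ j ∈ IR \ IB.image ψ, fibC In V P j) ≤ ∑ j ∈ IR \ IB.image ψ, fibC In V Q j := by
    refine Finset.sum_le_sum fun j hj => ?_
    rw [Finset.mem_sdiff, hIR, Finset.mem_filter] at hj
    rw [fibC_eq_halves In c₀ V P j, fibC_eq_halves In c₀ V Q j]
    have h1 := unmatched_le hc hP hQ hCd hV hj.1.1 hj.1.2 true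
    have h2 := unmatched_le hc hP hQ hCd hV hj.1.1 hj.1.2 false
    omega
  omega

end Count

end MultiExit

end ZoneZ

end PercRepro
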